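import Literature.Analysis.FluidPDE.PineauVicolCylinderRegularity
import Literature.Analysis.FluidPDE.SelfSimilar
import Literature.Analysis.FluidPDE.SpaceTimeCalculus
import Literature.Analysis.FluidPDE.EnstrophySplittingDissipation
import Literature.Analysis.FluidPDE.KNSSThm52Integrand

/-!
# Crux `SymmetricScarExists` (stmt-NavierStokesRegularity-11718), line `logtime-bernoulli-certificate`:
# stub `stub_apexScaleInvariantBounds` — the velocity half and the time derivatives
# (registered sub-goal `stub_apexScaleInvariantBounds_ofPressure`)

Helper file (`--supports stmt-NavierStokesRegularity-11718`; theorems only, no definitions, no named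
facts).  The registered stub `stub_apexScaleInvariantBounds` asks, for a classical solution `(v, q)` of
Navier–Stokes (`ν = 1`, `f = 0`) on the past `(−∞, 0) × ℝ³` with the Type-I bound
`‖v(t,x)‖ ≤ C/(‖x‖ + √(−t))` (`HasTypeIDecay C v`), for SOME classical pressure `q'` and ONE constant
`K` with the six scale-invariant bounds `(‖x‖+√(−t))²‖∇v‖ ≤ K`, `(‖x‖+√(−t))³‖D²v‖ ≤ K`,
`(‖x‖+√(−t))²|q'| ≤ K`, `(‖x‖+√(−t))³‖∇q'‖ ≤ K`, `(‖x‖+√(−t))³‖∂ₜv‖ ≤ K`, `(‖x‖+√(−t))⁴‖∇∂ₜv‖ ≤ K`.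
This file proves everything EXCEPT the pressure: 

* `exists_weight_pow_mul_norm_iteratedFDeriv_le` — the VELOCITY half at every order `n`:
  `(‖x‖+√(−t))^{n+1} ‖Dⁿv(t,·)(x)‖ ≤ K(n, C)` (the tree's Lemma 7.1 of Pineau–Vicol in physical
  variables, `PineauVicol2026.exists_forall_iteratedFDeriv_le_of_typeI` = Seregin–Šverák 2009 §2
  quantitative interior regularity at unit scale after the Navier–Stokes rescaling, with
  `‖x‖ + √(−t) ≤ 2 max{‖x‖, √(−t)}`);
* `timeDeriv_eq_of_classical` — `∂ₜv = Δv − ∇q − (v·∇)v` pointwise on `t < 0` (the momentum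
  equation; on the open time set the one-sided time derivative is the two-sided `timeDeriv`), and
  the resulting bounds `weight_pow_three_mul_norm_timeDeriv_le` (`(‖x‖+√(−t))³‖∂ₜv‖`) and
  `weight_pow_four_mul_norm_fderiv_timeDeriv_le` (`(‖x‖+√(−t))⁴‖∇∂ₜv‖`, through
  `D(∂ₜv) = D(Δv) − D(∇q) − D((v·∇)v)`, `‖D(Δv)‖ ≤ 6‖D³v‖`, `‖D(∇q)‖ ≤ ‖D²q‖`,
  `‖D((v·∇)v)‖ ≤ ‖Dv‖² + ‖D²v‖‖v‖`) from bounds on `∇q`, `D²q`;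
* `stub_apexScaleInvariantBounds_ofPressure` (registered sub-goal) — the stub follows from its
  PRESSURE HALF alone: a classical pressure `q'` for `v` with `(‖x‖+√(−t))²|q'| ≤ K`,
  `(‖x‖+√(−t))³‖∇q'‖ ≤ K` and the Hessian bound `(‖x‖+√(−t))⁴‖D²q'‖ ≤ K` (the latter feeds `∇∂ₜv`).

The pressure half (the Riesz pressure `Q[v(t)] = RᵢRⱼ(vᵢvⱼ)`: `∇q = ∇Q[v(t)]` by the tree's
`PineauVicol2026.gradient_pressure_eq_of_typeI_vertex`; Calderón–Zygmund-free pointwise bounds of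
`Q, ∇Q, D²Q` from the decay of `v` and its derivatives; joint smoothness of `(t,x) ↦ Q[v(t)](x)`) is
NOT here.

## References

* G. Seregin, V. Šverák, Comm. PDE 34 (2009) = arXiv:0804.1803, §2 p. 8. [SereginSverak2009]
* B. Pineau, V. Vicol, arXiv:2607.09619 (2026), Lemma 7.1. [PineauVicol2026]
-/

noncomputable section

open MeasureTheory Set Function Filter Topology
open scoped ContDiff Laplacian

namespace Summit.NavierStokesRegularity.NavierStokesRegularity.Theorems.SymmetricScarExists.LogtimeBernoulli

open Literature.Analysis.FluidPDE

/-! ### The velocity half: all spatial derivatives -/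

/-- **Scale-invariant bounds for all spatial derivatives of a classical Type-I solution on the
past**: for every order `n` and Type-I constant `C` there is `K = K(n, C) ≥ 0` with
`(‖x‖ + √(−t))^{n+1} ‖Dⁿv(t,·)(x)‖ ≤ K` for all `t < 0`, `x`, for every classical solution `(v, q)`
of Navier–Stokes (`ν = 1`, `f = 0`) on `(−∞, 0)` with `‖v(t,x)‖ ≤ C/(‖x‖+√(−t))` (the tree's
`PineauVicol2026.exists_forall_iteratedFDeriv_le_of_typeI`, i.e. Seregin–Šverák's quantitative
interior regularity at unit scale after rescaling, and `‖x‖ + √(−t) ≤ 2 max{‖x‖, √(−t)}`).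
[cite: SereginSverak2009, §2 p. 8] -/
theorem exists_weight_pow_mul_norm_iteratedFDeriv_le (n : ℕ) (C : ℝ) :
    ∃ K : ℝ, 0 ≤ K ∧ ∀ (v : ℝ → (EuclideanSpace ℝ (Fin 3)) → (EuclideanSpace ℝ (Fin 3)))
      (q : ℝ → (EuclideanSpace ℝ (Fin 3)) → ℝ),
      IsClassicalNSSolutionOn (Iio 0) 1 0 v q → HasTypeIDecay C v →
      ∀ t < (0 : ℝ), ∀ x : EuclideanSpace ℝ (Fin 3),
        (‖x‖ + Real.sqrt (-t)) ^ (n + 1) * ‖iteratedFDeriv ℝ n (v t) x‖ ≤ K := by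
  obtain ⟨K, hK0, hK⟩ := PineauVicol2026.exists_forall_iteratedFDeriv_le_of_typeI n C
  refine ⟨2 ^ (n + 1) * K, by positivity, fun v q hsol hdec t ht x => ?_⟩
  have hb := hK v q hsol (fun s hs y => hdec s hs y) t ht x
  set m : ℝ := max ‖x‖ (Real.sqrt (-t)) with hm
  have hst : 0 < Real.sqrt (-t) := Real.sqrt_pos.2 (by linarith)
  have hm0 : 0 < m := lt_max_of_lt_right hst
  have hRm : ‖x‖ + Real.sqrt (-t) ≤ 2 * m := by
    have h1 : ‖x‖ ≤ m := le_max_left _ _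
    have h2 : Real.sqrt (-t) ≤ m := le_max_right _ _
    linarith
  have hR0 : 0 ≤ ‖x‖ + Real.sqrt (-t) := by positivity
  calc (‖x‖ + Real.sqrt (-t)) ^ (n + 1) * ‖iteratedFDeriv ℝ n (v t) x‖
      ≤ (2 * m) ^ (n + 1) * (K * (m⁻¹) ^ (n + 1)) :=
        mul_le_mul (pow_le_pow_left₀ hR0 hRm _) hb (norm_nonneg _) (by positivity)
    _ = 2 ^ (n + 1) * K * (m * m⁻¹) ^ (n + 1) := by rw [mul_pow, mul_pow]; ring
    _ = 2 ^ (n + 1) * K := by rw [mul_inv_cancel₀ hm0.ne', one_pow, mul_one]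

/-- The first-order case in `fderiv` form: `(‖x‖+√(−t))² ‖∇v(t,x)‖ ≤ K(1, C)`. [cite: SereginSverak2009, §2 p. 8] -/
theorem exists_weight_sq_mul_norm_fderiv_le (C : ℝ) :
    ∃ K : ℝ, 0 ≤ K ∧ ∀ (v : ℝ → (EuclideanSpace ℝ (Fin 3)) → (EuclideanSpace ℝ (Fin 3)))
      (q : ℝ → (EuclideanSpace ℝ (Fin 3)) → ℝ),
      IsClassicalNSSolutionOn (Iio 0) 1 0 v q → HasTypeIDecay C v →
      ∀ t < (0 : ℝ), ∀ x : EuclideanSpace ℝ (Fin 3),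
        (‖x‖ + Real.sqrt (-t)) ^ 2 * ‖fderiv ℝ (v t) x‖ ≤ K := by
  obtain ⟨K, hK0, hK⟩ := exists_weight_pow_mul_norm_iteratedFDeriv_le 1 C
  refine ⟨K, hK0, fun v q hsol hdec t ht x => ?_⟩
  have h := hK v q hsol hdec t ht x
  rwa [norm_iteratedFDeriv_one] at h

/-- The Type-I bound in product form: `(‖x‖+√(−t)) ‖v(t,x)‖ ≤ C` for `t < 0`. [folklore] -/
theorem weight_mul_norm_le_of_hasTypeIDecay {C : ℝ}
    {v : ℝ → (EuclideanSpace ℝ (Fin 3)) → (EuclideanSpace ℝ (Fin 3))} (hdec : HasTypeIDecay C v)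
    {t : ℝ} (ht : t < 0) (x : EuclideanSpace ℝ (Fin 3)) :
    (‖x‖ + Real.sqrt (-t)) * ‖v t x‖ ≤ C := by
  have hst : 0 < Real.sqrt (-t) := Real.sqrt_pos.2 (by linarith)
  have hR : 0 < ‖x‖ + Real.sqrt (-t) := by positivity
  have h := hdec t ht x
  rw [le_div_iff₀ hR] at h
  linarith


/-! ### The momentum equation solved for the time derivative -/

section TimeDerivative

variable {v : ℝ → (EuclideanSpace ℝ (Fin 3)) → (EuclideanSpace ℝ (Fin 3))}
  {q : ℝ → (EuclideanSpace ℝ (Fin 3)) → ℝ}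

/-- **`∂ₜv = Δv − ∇q − (v·∇)v` on the past** for a classical solution of Navier–Stokes
(`ν = 1`, `f = 0`) on `(−∞, 0)`: the momentum equation, the one-sided time derivative within the
open time set `(−∞, 0)` being the two-sided `timeDeriv`. [folklore] -/
theorem timeDeriv_eq_of_classical (hcl : IsClassicalNSSolutionOn (Iio 0) 1 0 v q) {t : ℝ}
    (ht : t < 0) :
    timeDeriv v t = fun x => (Δ (v t)) x - gradient (q t) x - convect (v t) (v t) x := by
  funext x
  have hm := hcl.momentum t ht x
  rw [timeDerivWithin_eq_deriv isOpen_Iio ht v x, one_smul, Pi.zero_apply, Pi.zero_apply,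
    add_zero] at hm
  rw [timeDeriv_apply]
  exact eq_sub_of_add_eq hm

/-- **Pointwise bound for `∂ₜv`**: `‖∂ₜv‖ ≤ 3‖D²v‖ + ‖∇q‖ + ‖∇v‖ ‖v‖` (`‖Δv‖ ≤ 3‖D²v‖`,
`‖(v·∇)v‖ ≤ ‖∇v‖ ‖v‖`). [folklore] -/
theorem norm_timeDeriv_le (hcl : IsClassicalNSSolutionOn (Iio 0) 1 0 v q) {t : ℝ} (ht : t < 0)
    (x : EuclideanSpace ℝ (Fin 3)) :
    ‖timeDeriv v t x‖ ≤ 3 * ‖iteratedFDeriv ℝ 2 (v t) x‖ + ‖gradient (q t) x‖ +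
      ‖fderiv ℝ (v t) x‖ * ‖v t x‖ := by
  have e : timeDeriv v t x = (Δ (v t)) x - gradient (q t) x - convect (v t) (v t) x :=
    congrFun (timeDeriv_eq_of_classical hcl ht) x
  have h1 : ‖(Δ (v t)) x‖ ≤ 3 * ‖iteratedFDeriv ℝ 2 (v t) x‖ := norm_laplacian_le_three_mul _ _
  have h3 : ‖convect (v t) (v t) x‖ ≤ ‖fderiv ℝ (v t) x‖ * ‖v t x‖ := by
    rw [convect_apply]; exact ContinuousLinearMap.le_opNorm _ _
  have h4 : ‖(Δ (v t)) x - gradient (q t) x - convect (v t) (v t) x‖ ≤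
      ‖(Δ (v t)) x‖ + ‖gradient (q t) x‖ + ‖convect (v t) (v t) x‖ :=
    (norm_sub_le _ _).trans (add_le_add (norm_sub_le _ _) le_rfl)
  rw [e]
  linarith

/-- **`(‖x‖+√(−t))³ ‖∂ₜv‖ ≤ 3K₂ + K_q + K₁C`** from the scale-invariant bounds on `∇v` (`K₁`),
`D²v` (`K₂`), `∇q` (`K_q`) and the Type-I bound (`C`). [folklore] -/
theorem weight_pow_three_mul_norm_timeDeriv_le (hcl : IsClassicalNSSolutionOn (Iio 0) 1 0 v q)
    {C : ℝ} (hdec : HasTypeIDecay C v) {K₁ K₂ Kq : ℝ}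
    (h1 : ∀ t < (0 : ℝ), ∀ x : EuclideanSpace ℝ (Fin 3),
      (‖x‖ + Real.sqrt (-t)) ^ 2 * ‖fderiv ℝ (v t) x‖ ≤ K₁)
    (h2 : ∀ t < (0 : ℝ), ∀ x : EuclideanSpace ℝ (Fin 3),
      (‖x‖ + Real.sqrt (-t)) ^ 3 * ‖iteratedFDeriv ℝ 2 (v t) x‖ ≤ K₂)
    (hq : ∀ t < (0 : ℝ), ∀ x : EuclideanSpace ℝ (Fin 3),
      (‖x‖ + Real.sqrt (-t)) ^ 3 * ‖gradient (q t) x‖ ≤ Kq)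
    {t : ℝ} (ht : t < 0) (x : EuclideanSpace ℝ (Fin 3)) :
    (‖x‖ + Real.sqrt (-t)) ^ 3 * ‖timeDeriv v t x‖ ≤ 3 * K₂ + Kq + K₁ * C := by
  set R : ℝ := ‖x‖ + Real.sqrt (-t) with hR
  have hst : 0 < Real.sqrt (-t) := Real.sqrt_pos.2 (by linarith)
  have hR0 : 0 < R := by rw [hR]; positivity
  have hv0 := weight_mul_norm_le_of_hasTypeIDecay hdec ht x
  have hDv := h1 t ht x
  have hK₁ : 0 ≤ K₁ := le_trans (by positivity) hDv
  have hprod : R ^ 2 * ‖fderiv ℝ (v t) x‖ * (R * ‖v t x‖) ≤ K₁ * C :=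
    mul_le_mul hDv hv0 (by positivity) hK₁
  calc R ^ 3 * ‖timeDeriv v t x‖
      ≤ R ^ 3 * (3 * ‖iteratedFDeriv ℝ 2 (v t) x‖ + ‖gradient (q t) x‖ +
          ‖fderiv ℝ (v t) x‖ * ‖v t x‖) :=
        mul_le_mul_of_nonneg_left (norm_timeDeriv_le hcl ht x) (by positivity)
    _ = 3 * (R ^ 3 * ‖iteratedFDeriv ℝ 2 (v t) x‖) + R ^ 3 * ‖gradient (q t) x‖ +
          R ^ 2 * ‖fderiv ℝ (v t) x‖ * (R * ‖v t x‖) := by ring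
    _ ≤ 3 * K₂ + Kq + K₁ * C := by
        have := h2 t ht x
        have := hq t ht x
        gcongr

/-! ### The gradient of the time derivative -/

/-- `‖D(∇f)(x)‖ ≤ ‖D²f(x)‖` (the gradient is the Riesz image of the derivative, and the Riesz map
is an isometry). [folklore] -/
theorem norm_fderiv_gradient_le {f : (EuclideanSpace ℝ (Fin 3)) → ℝ} (hf : ContDiff ℝ 2 f)
    (x : EuclideanSpace ℝ (Fin 3)) :
    ‖fderiv ℝ (gradient f) x‖ ≤ ‖iteratedFDeriv ℝ 2 f x‖ := by
  have hD : HasFDerivAt (fderiv ℝ f) (fderiv ℝ (fderiv ℝ f) x) x :=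
    ((hf.fderiv_right (m := 1) le_rfl).differentiable one_ne_zero x).hasFDerivAt
  have hg : HasFDerivAt (gradient f)
      ((((InnerProductSpace.toDual ℝ (EuclideanSpace ℝ (Fin 3))).symm :
        ((EuclideanSpace ℝ (Fin 3)) →L[ℝ] ℝ) →L[ℝ] (EuclideanSpace ℝ (Fin 3)))).comp
        (fderiv ℝ (fderiv ℝ f) x)) x :=
    (InnerProductSpace.toDual ℝ (EuclideanSpace ℝ (Fin 3))).symm.hasFDerivAt.comp x hD
  rw [hg.fderiv]
  have hiso : ‖((InnerProductSpace.toDual ℝ (EuclideanSpace ℝ (Fin 3))).symm :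
      ((EuclideanSpace ℝ (Fin 3)) →L[ℝ] ℝ) →L[ℝ] (EuclideanSpace ℝ (Fin 3)))‖ ≤ 1 := by
    refine ContinuousLinearMap.opNorm_le_bound _ zero_le_one fun φ => ?_
    rw [one_mul]
    exact le_of_eq ((InnerProductSpace.toDual ℝ (EuclideanSpace ℝ (Fin 3))).symm.norm_map φ)
  calc _ ≤ ‖((InnerProductSpace.toDual ℝ (EuclideanSpace ℝ (Fin 3))).symm :
        ((EuclideanSpace ℝ (Fin 3)) →L[ℝ] ℝ) →L[ℝ] (EuclideanSpace ℝ (Fin 3)))‖ *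
        ‖fderiv ℝ (fderiv ℝ f) x‖ := ContinuousLinearMap.opNorm_comp_le _ _
    _ ≤ 1 * ‖fderiv ℝ (fderiv ℝ f) x‖ := by gcongr
    _ = ‖iteratedFDeriv ℝ 2 f x‖ := by
        rw [one_mul, ← norm_iteratedFDeriv_one (f := fderiv ℝ f), norm_iteratedFDeriv_fderiv]

/-- `‖D(Dv)(x)‖ = ‖D²v(x)‖`. [folklore] -/
theorem norm_fderiv_fderiv_eq_norm_iteratedFDeriv_two
    (w : (EuclideanSpace ℝ (Fin 3)) → (EuclideanSpace ℝ (Fin 3))) (x : EuclideanSpace ℝ (Fin 3)) :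
    ‖fderiv ℝ (fderiv ℝ w) x‖ = ‖iteratedFDeriv ℝ 2 w x‖ := by
  rw [← norm_iteratedFDeriv_one (f := fderiv ℝ w), norm_iteratedFDeriv_fderiv]

/-- `‖D((v·∇)v)(x)‖ ≤ ‖∇v(x)‖² + ‖D²v(x)‖ ‖v(x)‖` for a `C²` field
(`D(y ↦ Dv(y)[v(y)]) = Dv ∘ Dv + D²v[·, v]`). [folklore] -/
theorem norm_fderiv_convect_self_le {w : (EuclideanSpace ℝ (Fin 3)) → (EuclideanSpace ℝ (Fin 3))}
    (hw : ContDiff ℝ 2 w) (x : EuclideanSpace ℝ (Fin 3)) :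
    ‖fderiv ℝ (convect w w) x‖ ≤ ‖fderiv ℝ w x‖ ^ 2 + ‖iteratedFDeriv ℝ 2 w x‖ * ‖w x‖ := by
  have hDw : DifferentiableAt ℝ (fderiv ℝ w) x :=
    ((hw.fderiv_right (m := 1) le_rfl).differentiable one_ne_zero) x
  have hwx : DifferentiableAt ℝ w x := (hw.differentiable two_ne_zero) x
  have e : convect w w = fun y => fderiv ℝ w y (w y) := rfl
  rw [e, fderiv_clm_apply hDw hwx]
  calc ‖(fderiv ℝ w x).comp (fderiv ℝ w x) + (fderiv ℝ (fderiv ℝ w) x).flip (w x)‖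
      ≤ ‖(fderiv ℝ w x).comp (fderiv ℝ w x)‖ + ‖(fderiv ℝ (fderiv ℝ w) x).flip (w x)‖ :=
        norm_add_le _ _
    _ ≤ ‖fderiv ℝ w x‖ * ‖fderiv ℝ w x‖ + ‖(fderiv ℝ (fderiv ℝ w) x).flip‖ * ‖w x‖ :=
        add_le_add (ContinuousLinearMap.opNorm_comp_le _ _) (ContinuousLinearMap.le_opNorm _ _)
    _ = ‖fderiv ℝ w x‖ ^ 2 + ‖iteratedFDeriv ℝ 2 w x‖ * ‖w x‖ := by
        rw [ContinuousLinearMap.opNorm_flip, norm_fderiv_fderiv_eq_norm_iteratedFDeriv_two, sq]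

/-- `‖D(Δv)(x)‖ ≤ 6 ‖D³v(x)‖` for a `C³` field on `ℝ³` (the tree's
`norm_fderiv_laplacian_sq_le`: `‖D(Δv)‖² ≤ 27‖D³v‖² ≤ (6‖D³v‖)²`). [folklore] -/
theorem norm_fderiv_laplacian_le_six_mul {w : (EuclideanSpace ℝ (Fin 3)) → (EuclideanSpace ℝ (Fin 3))}
    (hw : ContDiff ℝ 3 w) (x : EuclideanSpace ℝ (Fin 3)) :
    ‖fderiv ℝ (Δ w) x‖ ≤ 6 * ‖iteratedFDeriv ℝ 3 w x‖ := by
  have h := norm_fderiv_laplacian_sq_le hw x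
  have h36 : ‖fderiv ℝ (Δ w) x‖ ^ 2 ≤ (6 * ‖iteratedFDeriv ℝ 3 w x‖) ^ 2 := by
    nlinarith [sq_nonneg ‖iteratedFDeriv ℝ 3 w x‖]
  exact (pow_le_pow_iff_left₀ (norm_nonneg _) (by positivity) two_ne_zero).1 h36

/-- **`D(∂ₜv) = D(Δv) − D(∇q) − D((v·∇)v)` on the past** (differentiate
`timeDeriv_eq_of_classical`; all three terms are smooth). [folklore] -/
theorem fderiv_timeDeriv_eq_of_classical (hcl : IsClassicalNSSolutionOn (Iio 0) 1 0 v q) {t : ℝ}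
    (ht : t < 0) (x : EuclideanSpace ℝ (Fin 3)) :
    fderiv ℝ (timeDeriv v t) x =
      fderiv ℝ (Δ (v t)) x - fderiv ℝ (gradient (q t)) x - fderiv ℝ (convect (v t) (v t)) x := by
  rw [timeDeriv_eq_of_classical hcl ht]
  have hv : ContDiff ℝ ∞ (v t) := hcl.contDiff_velocity ht
  have hp : ContDiff ℝ ∞ (q t) := hcl.contDiff_pressure ht
  have hΔ : Differentiable ℝ (Δ (v t)) :=
    (contDiff_laplacian (n := 1) (hv.of_le (by norm_cast))).differentiable one_ne_zero
  have hg : Differentiable ℝ (gradient (q t)) :=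
    ((InnerProductSpace.toDual ℝ (EuclideanSpace ℝ (Fin 3))).symm.contDiff.comp
      (hp.fderiv_right (m := 1) (by norm_cast))).differentiable one_ne_zero
  have hc : Differentiable ℝ (convect (v t) (v t)) :=
    (contDiff_convect_self (n := 1) (hv.of_le (by norm_cast))).differentiable one_ne_zero
  have e1 : (fun x => (Δ (v t)) x - gradient (q t) x - convect (v t) (v t) x) =
      fun x => (fun y => (Δ (v t)) y - gradient (q t) y) x - convect (v t) (v t) x := rfl
  have h12 : DifferentiableAt ℝ (fun y => (Δ (v t)) y - gradient (q t) y) x := (hΔ x).sub (hg x)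
  rw [e1, fderiv_fun_sub h12 (hc x), fderiv_fun_sub (hΔ x) (hg x)]

/-- **Pointwise bound for `∇∂ₜv`**: `‖D(∂ₜv)‖ ≤ 6‖D³v‖ + ‖D²q‖ + ‖∇v‖² + ‖D²v‖ ‖v‖`. [folklore] -/
theorem norm_fderiv_timeDeriv_le (hcl : IsClassicalNSSolutionOn (Iio 0) 1 0 v q) {t : ℝ} (ht : t < 0)
    (x : EuclideanSpace ℝ (Fin 3)) :
    ‖fderiv ℝ (timeDeriv v t) x‖ ≤ 6 * ‖iteratedFDeriv ℝ 3 (v t) x‖ + ‖iteratedFDeriv ℝ 2 (q t) x‖ +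
      (‖fderiv ℝ (v t) x‖ ^ 2 + ‖iteratedFDeriv ℝ 2 (v t) x‖ * ‖v t x‖) := by
  have hv : ContDiff ℝ ∞ (v t) := hcl.contDiff_velocity ht
  have hp : ContDiff ℝ ∞ (q t) := hcl.contDiff_pressure ht
  rw [fderiv_timeDeriv_eq_of_classical hcl ht x]
  have b1 := norm_fderiv_laplacian_le_six_mul (hv.of_le (by norm_cast)) x
  have b2 := norm_fderiv_gradient_le (hp.of_le (by norm_cast)) x
  have b3 := norm_fderiv_convect_self_le (hv.of_le (by norm_cast)) x
  have b4 : ‖fderiv ℝ (Δ (v t)) x - fderiv ℝ (gradient (q t)) x - fderiv ℝ (convect (v t) (v t)) x‖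
      ≤ ‖fderiv ℝ (Δ (v t)) x‖ + ‖fderiv ℝ (gradient (q t)) x‖ +
        ‖fderiv ℝ (convect (v t) (v t)) x‖ :=
    (norm_sub_le _ _).trans (add_le_add (norm_sub_le _ _) le_rfl)
  linarith

/-- **`(‖x‖+√(−t))⁴ ‖∇∂ₜv‖ ≤ 6K₃ + K_h + K₁² + K₂C`** from the scale-invariant bounds on `∇v` (`K₁`),
`D²v` (`K₂`), `D³v` (`K₃`), the pressure Hessian (`K_h`) and the Type-I bound (`C`). [folklore] -/
theorem weight_pow_four_mul_norm_fderiv_timeDeriv_le (hcl : IsClassicalNSSolutionOn (Iio 0) 1 0 v q)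
    {C : ℝ} (hdec : HasTypeIDecay C v) {K₁ K₂ K₃ Kh : ℝ}
    (h1 : ∀ t < (0 : ℝ), ∀ x : EuclideanSpace ℝ (Fin 3),
      (‖x‖ + Real.sqrt (-t)) ^ 2 * ‖fderiv ℝ (v t) x‖ ≤ K₁)
    (h2 : ∀ t < (0 : ℝ), ∀ x : EuclideanSpace ℝ (Fin 3),
      (‖x‖ + Real.sqrt (-t)) ^ 3 * ‖iteratedFDeriv ℝ 2 (v t) x‖ ≤ K₂)
    (h3 : ∀ t < (0 : ℝ), ∀ x : EuclideanSpace ℝ (Fin 3),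
      (‖x‖ + Real.sqrt (-t)) ^ 4 * ‖iteratedFDeriv ℝ 3 (v t) x‖ ≤ K₃)
    (hh : ∀ t < (0 : ℝ), ∀ x : EuclideanSpace ℝ (Fin 3),
      (‖x‖ + Real.sqrt (-t)) ^ 4 * ‖iteratedFDeriv ℝ 2 (q t) x‖ ≤ Kh)
    {t : ℝ} (ht : t < 0) (x : EuclideanSpace ℝ (Fin 3)) :
    (‖x‖ + Real.sqrt (-t)) ^ 4 * ‖fderiv ℝ (timeDeriv v t) x‖ ≤ 6 * K₃ + Kh + K₁ ^ 2 + K₂ * C := by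
  set R : ℝ := ‖x‖ + Real.sqrt (-t) with hR
  have hst : 0 < Real.sqrt (-t) := Real.sqrt_pos.2 (by linarith)
  have hR0 : 0 < R := by rw [hR]; positivity
  have hv0 := weight_mul_norm_le_of_hasTypeIDecay hdec ht x
  have hDv := h1 t ht x
  have hD2 := h2 t ht x
  have hK₁ : 0 ≤ K₁ := le_trans (by positivity) hDv
  have hK₂ : 0 ≤ K₂ := le_trans (by positivity) hD2
  have hsq : (R ^ 2 * ‖fderiv ℝ (v t) x‖) ^ 2 ≤ K₁ ^ 2 := pow_le_pow_left₀ (by positivity) hDv 2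
  have hprod : R ^ 3 * ‖iteratedFDeriv ℝ 2 (v t) x‖ * (R * ‖v t x‖) ≤ K₂ * C :=
    mul_le_mul hD2 hv0 (by positivity) hK₂
  calc R ^ 4 * ‖fderiv ℝ (timeDeriv v t) x‖
      ≤ R ^ 4 * (6 * ‖iteratedFDeriv ℝ 3 (v t) x‖ + ‖iteratedFDeriv ℝ 2 (q t) x‖ +
          (‖fderiv ℝ (v t) x‖ ^ 2 + ‖iteratedFDeriv ℝ 2 (v t) x‖ * ‖v t x‖)) :=
        mul_le_mul_of_nonneg_left (norm_fderiv_timeDeriv_le hcl ht x) (by positivity)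
    _ = 6 * (R ^ 4 * ‖iteratedFDeriv ℝ 3 (v t) x‖) + R ^ 4 * ‖iteratedFDeriv ℝ 2 (q t) x‖ +
          ((R ^ 2 * ‖fderiv ℝ (v t) x‖) ^ 2 +
            R ^ 3 * ‖iteratedFDeriv ℝ 2 (v t) x‖ * (R * ‖v t x‖)) := by ring
    _ ≤ 6 * K₃ + Kh + (K₁ ^ 2 + K₂ * C) := by
        have := h3 t ht x
        have := hh t ht x
        gcongr
    _ = 6 * K₃ + Kh + K₁ ^ 2 + K₂ * C := by ring

end TimeDerivative


/-! ### The stub from its pressure half -/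

/-- A Type-I bound with constant `C` is a Type-I bound with constant `|C|`. [folklore] -/
theorem hasTypeIDecay_abs {C : ℝ} {v : ℝ → (EuclideanSpace ℝ (Fin 3)) → (EuclideanSpace ℝ (Fin 3))}
    (hdec : HasTypeIDecay C v) : HasTypeIDecay |C| v := fun t ht x =>
  (hdec t ht x).trans (div_le_div_of_nonneg_right (le_abs_self C)
    (by have := Real.sqrt_pos.2 (neg_pos.2 ht); positivity))

/-- **Registered sub-goal `stub_apexScaleInvariantBounds_ofPressure`: the stub
`stub_apexScaleInvariantBounds` follows from its PRESSURE HALF.**  If every classical Type-I solution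
`(v, q)` of Navier–Stokes (`ν = 1`, `f = 0`) on the past admits a classical pressure `q'` with the
scale-invariant bounds `(‖x‖+√(−t))²|q'| ≤ K`, `(‖x‖+√(−t))³‖∇q'‖ ≤ K`, `(‖x‖+√(−t))⁴‖D²q'‖ ≤ K`
(the Riesz pressure `Q[v(t)] = RᵢRⱼ(vᵢvⱼ)` is the candidate: Seregin–Šverák 2009 §2, Pineau–Vicol 2026
Lemma 2.1/7.1), then `(v, q')` obeys all six bounds of the stub with one constant: the velocity bounds
at orders `1, 2, 3` are `exists_weight_pow_mul_norm_iteratedFDeriv_le`, and `∂ₜv`, `∇∂ₜv` are read off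
the momentum equation (`weight_pow_three_mul_norm_timeDeriv_le`,
`weight_pow_four_mul_norm_fderiv_timeDeriv_le`). [cite: SereginSverak2009, §2 p. 8] -/
theorem stub_apexScaleInvariantBounds_ofPressure :
    (∀ (v : ℝ → EuclideanSpace ℝ (Fin 3) → EuclideanSpace ℝ (Fin 3)) (q : ℝ → EuclideanSpace ℝ (Fin 3) → ℝ) (C : ℝ), Literature.Analysis.FluidPDE.IsClassicalNSSolutionOn (Set.Iio 0) 1 0 v q → Literature.Analysis.FluidPDE.HasTypeIDecay C v → ∃ (q' : ℝ → EuclideanSpace ℝ (Fin 3) → ℝ) (K : ℝ), Literature.Analysis.FluidPDE.IsClassicalNSSolutionOn (Set.Iio 0) 1 0 v q' ∧ ∀ t < (0 : ℝ), ∀ (x : EuclideanSpace ℝ (Fin 3)), (‖x‖ + Real.sqrt (-t)) ^ 2 * |q' t x| ≤ K ∧ (‖x‖ + Real.sqrt (-t)) ^ 3 * ‖gradient (q' t) x‖ ≤ K ∧ (‖x‖ + Real.sqrt (-t)) ^ 4 * ‖iteratedFDeriv ℝ 2 (q' t) x‖ ≤ K) → ∀ (v : ℝ → EuclideanSpace ℝ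 (Fin 3) → EuclideanSpace ℝ (Fin 3)) (q : ℝ → EuclideanSpace ℝ (Fin 3) → ℝ) (C : ℝ), Literature.Analysis.FluidPDE.IsClassicalNSSolutionOn (Set.Iio 0) 1 0 v q → Literature.Analysis.FluidPDE.HasTypeIDecay C v → ∃ (q' : ℝ → EuclideanSpace ℝ (Fin 3) → ℝ) (K : ℝ), Literature.Analysis.FluidPDE.IsClassicalNSSolutionOn (Set.Iio 0) 1 0 v q' ∧ ∀ t < (0 : ℝ), ∀ (x : EuclideanSpace ℝ (Fin 3)), (‖x‖ + Real.sqrt (-t)) ^ 2 * ‖fderiv ℝ (v t) x‖ ≤ K ∧ (‖x‖ + Real.sqrt (-t)) ^ 3 * ‖iteratedFDeriv ℝ 2 (v t) x‖ ≤ K ∧ (‖x‖ + Real.sqrt (-t)) ^ 2 * |q' t x| ≤ K ∧ (‖x‖ + Real.sqrt (-t)) ^ 3 * ‖gradient (q' t) x‖ ≤ K ∧ (‖x‖ + Real.sqrt (-t)) ^ 3 * ‖Literature.Analysis.FluidPDE.timeDeriv v t x‖ ≤ K ∧ (‖x‖ + Real.sqrt (-t)) ^ 4 * ‖fderiv ℝ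 (Literature.Analysis.FluidPDE.timeDeriv v t) x‖ ≤ K := by
  intro hP v q C hsol hdec
  obtain ⟨q', Kp, hsol', hb⟩ := hP v q C hsol hdec
  obtain ⟨K₁, hK₁, h1⟩ := exists_weight_sq_mul_norm_fderiv_le C
  obtain ⟨K₂, hK₂, h2⟩ := exists_weight_pow_mul_norm_iteratedFDeriv_le 2 C
  obtain ⟨K₃, hK₃, h3⟩ := exists_weight_pow_mul_norm_iteratedFDeriv_le 3 C
  have hdec' : HasTypeIDecay |C| v := hasTypeIDecay_abs hdec
  have h1v := h1 v q hsol hdec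
  have h2v := h2 v q hsol hdec
  have h3v := h3 v q hsol hdec
  have hgq : ∀ t < (0 : ℝ), ∀ x : EuclideanSpace ℝ (Fin 3),
      (‖x‖ + Real.sqrt (-t)) ^ 3 * ‖gradient (q' t) x‖ ≤ |Kp| := fun t ht x =>
    ((hb t ht x).2.1).trans (le_abs_self _)
  have hhq : ∀ t < (0 : ℝ), ∀ x : EuclideanSpace ℝ (Fin 3),
      (‖x‖ + Real.sqrt (-t)) ^ 4 * ‖iteratedFDeriv ℝ 2 (q' t) x‖ ≤ |Kp| := fun t ht x =>
    ((hb t ht x).2.2).trans (le_abs_self _)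
  set Kbig : ℝ := K₁ + K₂ + |Kp| + (3 * K₂ + |Kp| + K₁ * |C|) + (6 * K₃ + |Kp| + K₁ ^ 2 + K₂ * |C|)
    with hKbig
  have hKp0 : 0 ≤ |Kp| := abs_nonneg _
  have hC0 : 0 ≤ |C| := abs_nonneg _
  have hK₁C : 0 ≤ K₁ * |C| := mul_nonneg hK₁ hC0
  have hK₂C : 0 ≤ K₂ * |C| := mul_nonneg hK₂ hC0
  have hK₁2 : 0 ≤ K₁ ^ 2 := sq_nonneg _
  refine ⟨q', Kbig, hsol', fun t ht x => ⟨?_, ?_, ?_, ?_, ?_, ?_⟩⟩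
  · exact (h1v t ht x).trans (by rw [hKbig]; linarith)
  · exact (h2v t ht x).trans (by rw [hKbig]; linarith)
  · exact (((hb t ht x).1).trans (le_abs_self _)).trans (by rw [hKbig]; linarith)
  · exact (hgq t ht x).trans (by rw [hKbig]; linarith)
  · exact (weight_pow_three_mul_norm_timeDeriv_le hsol' hdec' h1v h2v hgq ht x).trans
      (by rw [hKbig]; linarith)
  · exact (weight_pow_four_mul_norm_fderiv_timeDeriv_le hsol' hdec' h1v h2v h3v hhq ht x).trans
      (by rw [hKbig]; linarith)

end Summit.NavierStokesRegularity.NavierStokesRegularity.Theorems.SymmetricScarExists.LogtimeBernoulli
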